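import Literature.NumberTheory.NumberFields.UnramifiedCubicBaseChange
import Mathlib.FieldTheory.Galois.GaloisClosure
import Mathlib.FieldTheory.LinearDisjoint
import Mathlib.NumberTheory.RamificationInertia.Unramified
import HarnessLib

/-!
# Lifting a cyclic unramified extension of prime degree along a quadratic extension

Topic `NumberTheory/NumberFields`.  Theorem-only file (no definition, no named fact), unconditional.

The field-theoretic bookkeeping behind the first step of the proof of Kummer's theorem
`p ∣ h⁺ ⟹ p ∣ h⁻` (Lang, *Cyclotomic Fields I and II*, Ch. 13 §2, Thm. 2.1 (ii) and Thm. 2.2):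
an unramified cyclic extension `E/F` of odd prime degree `p` of the totally real field `F = K⁺`
(class field theory, `p ∣ h(K⁺)`) is lifted to the CM field `K`, `[K : F] = 2`.  Inside `K̄` let
`K₁` be the image of `K` and `M = K₁ E` the compositum, viewed as an intermediate field of `K̄/K`.
Then (`§2`) `M/K` is Galois of degree `p` (so cyclic), (`§3`) unramified at every finite prime of
`K` (`e(𝔓|K) ∣ p` and `e(𝔓|K) ≤ e(𝔓|F) = e(𝔓|E) ≤ [M : E] = 2`), (`§4`) stable under every
`F`-automorphism `g` of `K̄`, and every such `g` commutes on `M` with every `K`-automorphism of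
`K̄` (`Gal(M/F) ↪ Gal(K/F) × Gal(E/F)` is abelian) — so that a lift `g` of complex conjugation acts
on the Kummer generator of `M/K` (used in `KummerPlusMinusClassNumber.lean`).

## Main results (`F K : Type` number fields, `K` an `F`-algebra, `Ω = AlgebraicClosure K`,
`E : IntermediateField F Ω`, `M : IntermediateField K Ω` with
`M.restrictScalars F = (K → Ω).fieldRange ⊔ E`)

* `QuadraticLift.exists_restrictScalars_eq` — such an `M` exists.
* `QuadraticLift.isGalois` — `E/F`, `K/F` normal ⟹ `M/K` Galois.
* `QuadraticLift.finrank_eq` — `[K:F] = 2`, `[E:F]` odd, `E/F` Galois ⟹ `[M:K] = [E:F]`.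
* `QuadraticLift.isUnramifiedIn` — moreover `[E:F] = p` an odd prime and `E/F` unramified at all
  finite primes ⟹ `M/K` unramified at all finite primes of `K`.
* `QuadraticLift.map_mem`, `QuadraticLift.apply_comm` — stability under `Aut(Ω/F)` and the
  commutation `g (h y) = h (g y)` (`g ∈ Aut(Ω/F)`, `h ∈ Aut(Ω/K)`, `y ∈ M`) when `Gal(E/F)` is cyclic.

## References

* S. Lang, *Cyclotomic Fields I and II*, GTM 121 (1990), Ch. 13 §2 (proof of Thm. 2.1; "`K_∞ = K K_∞⁺`
  is the lifting over `K`"), Ch. 3 §4 Lemma to Thm. 4.3. [Lang1990]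
* J. Neukirch, *Algebraic Number Theory* (1999), Ch. II §7 Prop. (7.2) (base change of unramified
  extensions). [NeukirchANT1999]
-/

noncomputable section

open NumberField IsDedekindDomain Module IntermediateField

namespace Literature.NumberTheory.NumberFields.QuadraticLift

variable {F K : Type} [Field F] [Field K] [Algebra F K]

/-! ### §1. The compositum `M = K₁ E` as an intermediate field of `K̄/K` -/

/-- The image `K₁` of `K` in `K̄`, as an intermediate field over `F`, is `F`-isomorphic to `K`.
[folklore] -/
private theorem finrank_fieldRange_eq [FiniteDimensional F K] :
    finrank F (IsScalarTower.toAlgHom F K (AlgebraicClosure K)).fieldRange = finrank F K :=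
  (AlgEquiv.ofInjectiveField (IsScalarTower.toAlgHom F K (AlgebraicClosure K))).toLinearEquiv.finrank_eq.symm

/-- `K₁` is finite over `F` when `K` is. [folklore] -/
private theorem finiteDimensional_fieldRange [FiniteDimensional F K] :
    FiniteDimensional F (IsScalarTower.toAlgHom F K (AlgebraicClosure K)).fieldRange :=
  LinearEquiv.finiteDimensional (AlgEquiv.ofInjectiveField (IsScalarTower.toAlgHom F K (AlgebraicClosure K))).toLinearEquiv

/-- **The compositum `K₁ E ⊆ K̄` is an intermediate field of `K̄/K`**: there is
`M : IntermediateField K K̄` with `M.restrictScalars F = K₁ ⊔ E`.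
[cite: Lang1990, Ch. 13 §2 (proof of Thm. 2.1: the lifting `K K_∞⁺` over `K`)] [folklore] -/
theorem exists_restrictScalars_eq (E : IntermediateField F (AlgebraicClosure K)) :
    ∃ M : IntermediateField K (AlgebraicClosure K),
      M.restrictScalars F = (IsScalarTower.toAlgHom F K (AlgebraicClosure K)).fieldRange ⊔ E := by
  refine ⟨((IsScalarTower.toAlgHom F K (AlgebraicClosure K)).fieldRange ⊔ E).toSubfield.toIntermediateField
    fun x => ?_, ?_⟩
  · exact (le_sup_left : (IsScalarTower.toAlgHom F K (AlgebraicClosure K)).fieldRange ≤ _) ⟨x, rfl⟩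
  · ext x
    exact Iff.rfl

/-- Membership in `M` is membership in `K₁ ⊔ E`.
[cite: Lang1990, Ch. 13 §2 (proof of Thm. 2.1: the lifting `K K_∞⁺` over `K`)] [folklore] -/
theorem mem_iff {E : IntermediateField F (AlgebraicClosure K)}
    {M : IntermediateField K (AlgebraicClosure K)}
    (hM : M.restrictScalars F =
      (IsScalarTower.toAlgHom F K (AlgebraicClosure K)).fieldRange ⊔ E)
    (x : (AlgebraicClosure K)) : x ∈ M ↔ x ∈ (IsScalarTower.toAlgHom F K (AlgebraicClosure K)).fieldRange ⊔ E := by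
  rw [← hM, mem_restrictScalars]

/-- `E ⊆ M = K₁ E`.
[cite: Lang1990, Ch. 13 §2 (proof of Thm. 2.1: the lifting `K K_∞⁺` over `K`)] [folklore] -/
theorem mem_of_mem {E : IntermediateField F (AlgebraicClosure K)}
    {M : IntermediateField K (AlgebraicClosure K)}
    (hM : M.restrictScalars F =
      (IsScalarTower.toAlgHom F K (AlgebraicClosure K)).fieldRange ⊔ E)
    {x : (AlgebraicClosure K)} (hx : x ∈ E) : x ∈ M :=
  (mem_iff hM x).mpr ((le_sup_right : E ≤ _) hx)

/-- `M/K` is finite when `E/F` and `K/F` are.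
[cite: Lang1990, Ch. 13 §2 (proof of Thm. 2.1: the lifting `K K_∞⁺` over `K`)] [folklore] -/
theorem finiteDimensional {E : IntermediateField F (AlgebraicClosure K)}
    {M : IntermediateField K (AlgebraicClosure K)}
    (hM : M.restrictScalars F =
      (IsScalarTower.toAlgHom F K (AlgebraicClosure K)).fieldRange ⊔ E)
    [FiniteDimensional F K] [FiniteDimensional F E] :
    FiniteDimensional K M := by
  haveI := finiteDimensional_fieldRange (F := F) (K := K)
  haveI : FiniteDimensional F ↥((IsScalarTower.toAlgHom F K (AlgebraicClosure K)).fieldRange ⊔ E) :=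
    IntermediateField.finiteDimensional_sup _ _
  haveI : FiniteDimensional F (M.restrictScalars F) := by rw [hM]; infer_instance
  have h : FiniteDimensional F M := ‹FiniteDimensional F (M.restrictScalars F)›
  exact Module.Finite.of_restrictScalars_finite F K M

/-! ### §2. `M/K` is Galois of degree `[E : F]` -/

/-- The image `K₁` of a normal `K/F` is stable under `Aut(K̄/F)`. [folklore] -/
private theorem map_fieldRange_eq [Normal F K]
    (g : (AlgebraicClosure K) ≃ₐ[F] (AlgebraicClosure K)) :
    (IsScalarTower.toAlgHom F K (AlgebraicClosure K)).fieldRange.map (g : (AlgebraicClosure K) →ₐ[F] (AlgebraicClosure K)) =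
      (IsScalarTower.toAlgHom F K (AlgebraicClosure K)).fieldRange := by
  haveI : Normal F (IsScalarTower.toAlgHom F K (AlgebraicClosure K)).fieldRange :=
    Normal.of_algEquiv (AlgEquiv.ofInjectiveField (IsScalarTower.toAlgHom F K (AlgebraicClosure K)))
  exact IntermediateField.normal_iff_forall_map_eq'.mp inferInstance g

/-- **`M` is stable under `Aut(K̄/F)`** when `K/F` and `E/F` are normal: `g(M) = M`.
[folklore] -/
private theorem map_restrictScalars_eq {E : IntermediateField F (AlgebraicClosure K)}
    {M : IntermediateField K (AlgebraicClosure K)}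
    (hM : M.restrictScalars F =
      (IsScalarTower.toAlgHom F K (AlgebraicClosure K)).fieldRange ⊔ E)
    [Normal F K] [Normal F E] (g : (AlgebraicClosure K) ≃ₐ[F] (AlgebraicClosure K)) :
    (M.restrictScalars F).map (g : (AlgebraicClosure K) →ₐ[F] (AlgebraicClosure K)) =
      M.restrictScalars F := by
  rw [hM, IntermediateField.map_sup, map_fieldRange_eq,
    IntermediateField.normal_iff_forall_map_eq'.mp inferInstance g]

/-- **`g(M) ⊆ M` for every `g ∈ Aut(K̄/F)`** (`K/F`, `E/F` normal: the compositum of normal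
extensions is stable under `F`-automorphisms).
[cite: Lang1990, Ch. 13 §2 (proof of Thm. 2.1: the lifting `K K_∞⁺` over `K`)] [folklore] -/
theorem map_mem {E : IntermediateField F (AlgebraicClosure K)}
    {M : IntermediateField K (AlgebraicClosure K)}
    (hM : M.restrictScalars F =
      (IsScalarTower.toAlgHom F K (AlgebraicClosure K)).fieldRange ⊔ E)
    [Normal F K] [Normal F E] (g : (AlgebraicClosure K) ≃ₐ[F] (AlgebraicClosure K)) {y : (AlgebraicClosure K)} (hy : y ∈ M) : g y ∈ M := by
  have h := map_restrictScalars_eq hM g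
  have : g y ∈ (M.restrictScalars F).map (g : (AlgebraicClosure K) →ₐ[F] (AlgebraicClosure K)) := ⟨y, hy, rfl⟩
  rw [h, mem_restrictScalars] at this
  exact this

/-- **`M/K` is Galois** when `K/F` and `E/F` are normal (`h(M) = M` for every `h ∈ Aut(K̄/K)`,
since `h` is `F`-linear). [cite: Lang1990, Ch. 3 §4, Lemma to Thm. 4.3] [folklore] -/
theorem isGalois {E : IntermediateField F (AlgebraicClosure K)}
    {M : IntermediateField K (AlgebraicClosure K)}
    (hM : M.restrictScalars F =
      (IsScalarTower.toAlgHom F K (AlgebraicClosure K)).fieldRange ⊔ E)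
    [PerfectField K] [Normal F K] [Normal F E] [FiniteDimensional F K] [FiniteDimensional F E] :
    IsGalois K M := by
  haveI := finiteDimensional hM
  haveI : Algebra.IsSeparable K M := Algebra.IsAlgebraic.isSeparable_of_perfectField
  haveI : Normal K M := by
    rw [IntermediateField.normal_iff_forall_map_le']
    intro h
    rintro _ ⟨y, hy, rfl⟩
    exact map_mem hM (h.restrictScalars F) hy
  exact ⟨⟩

/-- `K₁ ∩ E = F` when `[K:F]` and `[E:F]` are coprime. [folklore] -/
private theorem fieldRange_inf_eq_bot {E : IntermediateField F (AlgebraicClosure K)}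
    [FiniteDimensional F K] [FiniteDimensional F E]
    (hcop : Nat.Coprime (finrank F K) (finrank F E)) :
    (IsScalarTower.toAlgHom F K (AlgebraicClosure K)).fieldRange ⊓ E = ⊥ := by
  haveI := finiteDimensional_fieldRange (F := F) (K := K)
  rw [← IntermediateField.finrank_eq_one_iff]
  have h1 : finrank F ↥((IsScalarTower.toAlgHom F K (AlgebraicClosure K)).fieldRange ⊓ E) ∣ finrank F K := by
    rw [← finrank_fieldRange_eq (F := F) (K := K)]
    exact IntermediateField.finrank_dvd_of_le_right inf_le_left
  have h2 : finrank F ↥((IsScalarTower.toAlgHom F K (AlgebraicClosure K)).fieldRange ⊓ E) ∣ finrank F E :=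
    IntermediateField.finrank_dvd_of_le_right inf_le_right
  exact Nat.eq_one_of_dvd_coprimes hcop h1 h2

/-- **`[M : K] = [E : F]`** when `E/F` is Galois and `[K:F]`, `[E:F]` are coprime
(`[K₁ E : F] = [K₁ : F][E : F]` by linear disjointness). [cite: Lang1990, Ch. 3 §4, Lemma to Thm. 4.3]
[folklore] -/
theorem finrank_eq {E : IntermediateField F (AlgebraicClosure K)}
    {M : IntermediateField K (AlgebraicClosure K)}
    (hM : M.restrictScalars F =
      (IsScalarTower.toAlgHom F K (AlgebraicClosure K)).fieldRange ⊔ E)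
    [FiniteDimensional F K] [FiniteDimensional F E] [IsGalois F E]
    (hcop : Nat.Coprime (finrank F K) (finrank F E)) : finrank K M = finrank F E := by
  haveI := finiteDimensional hM
  haveI := finiteDimensional_fieldRange (F := F) (K := K)
  have hsup : finrank F ↥((IsScalarTower.toAlgHom F K (AlgebraicClosure K)).fieldRange ⊔ E) =
      finrank F K * finrank F E := by
    rw [sup_comm, ← finrank_fieldRange_eq (F := F) (K := K), mul_comm]
    exact (IntermediateField.LinearDisjoint.of_inf_eq_bot
      (by rw [inf_comm]; exact fieldRange_inf_eq_bot hcop)).finrank_sup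
  have hM' : finrank F M = finrank F K * finrank F E := by
    rw [← hsup, ← hM]
    rfl
  have htower : finrank F K * finrank K M = finrank F M := Module.finrank_mul_finrank F K M
  rw [hM'] at htower
  exact Nat.eq_of_mul_eq_mul_left Module.finrank_pos htower

/-! ### §3. `M/K` is unramified at every finite prime -/

/-- **Unramified base change, numerically.**  `[K:F] = 2`, `E/F` Galois of odd prime degree `p`,
unramified at every finite prime of `F`; then `M = K₁E` is unramified over `K` at every finite prime:
for a prime `𝔓` of `M`, `e(𝔓|K) ∣ [M:K] = p` while
`e(𝔓|K) ≤ e(𝔓|F) = e(𝔓 ∩ E|F)·e(𝔓|E) = e(𝔓|E) ≤ [M:E] = 2`.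
[cite: NeukirchANT1999, Ch. II §7 Prop. (7.2)] [cite: Lang1990, Ch. 13 §2, Thm. 2.1 (proof)] -/
theorem isUnramifiedIn {E : IntermediateField F (AlgebraicClosure K)}
    {M : IntermediateField K (AlgebraicClosure K)}
    (hM : M.restrictScalars F =
      (IsScalarTower.toAlgHom F K (AlgebraicClosure K)).fieldRange ⊔ E)
    [NumberField F] [NumberField K] [FiniteDimensional F E] [IsGalois F E]
    (h2 : finrank F K = 2) {p : ℕ} (hp : p.Prime) (hp2 : p ≠ 2) (hpE : finrank F E = p)
    (hunr : ∀ v : HeightOneSpectrum (𝓞 F), Algebra.IsUnramifiedIn (𝓞 E) v.asIdeal) :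
    ∀ v : HeightOneSpectrum (𝓞 K), Algebra.IsUnramifiedIn (𝓞 M) v.asIdeal := by
  classical
  haveI : FiniteDimensional F K := Module.finite_of_finrank_eq_succ h2
  haveI : Normal F K := by
    haveI : Algebra.IsQuadraticExtension F K := ⟨h2⟩
    infer_instance
  haveI := finiteDimensional hM
  haveI := isGalois hM
  haveI : NumberField E := NumberField.of_module_finite F E
  haveI : NumberField M := NumberField.of_module_finite K M
  have hcop : Nat.Coprime (finrank F K) (finrank F E) := by
    rw [h2, hpE]
    exact (Nat.coprime_primes Nat.prime_two hp).mpr (Ne.symm hp2)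
  have hKM : finrank K M = p := (finrank_eq hM hcop).trans hpE
  -- the inclusion `E → M` as an algebra
  let f : E →ₐ[F] M :=
    { toFun := fun x => ⟨x, mem_of_mem hM x.2⟩
      map_one' := rfl
      map_mul' := fun _ _ => rfl
      map_zero' := rfl
      map_add' := fun _ _ => rfl
      commutes' := fun _ => rfl }
  letI : Algebra E M := f.toRingHom.toAlgebra
  haveI : IsScalarTower F E M := IsScalarTower.of_algebraMap_eq fun _ => rfl
  haveI : Module.Finite E M := Module.Finite.of_restrictScalars_finite F E M
  have hEM : finrank E M = 2 := by
    have h := Module.finrank_mul_finrank F E M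
    have hFM : finrank F M = 2 * p := by
      rw [← Module.finrank_mul_finrank F K M, h2, hKM]
    rw [hFM, hpE, mul_comm] at h
    exact Nat.eq_of_mul_eq_mul_right hp.pos h
  intro v
  rw [Algebra.isUnramifiedIn_iff_forall_ramificationIdx_eq_one]
  intro P hP hPv
  haveI := hP
  have hP0 : P ≠ ⊥ := Ideal.ne_bot_of_liesOver_of_ne_bot v.ne_bot P
  haveI : P.IsMaximal := hP.isMaximal hP0
  haveI : (P.under (𝓞 E)).IsMaximal := Ideal.IsMaximal.under (𝓞 E) P
  haveI : (P.under (𝓞 F)).IsMaximal := Ideal.IsMaximal.under (𝓞 F) P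
  haveI : (P.under (𝓞 K)).IsMaximal := Ideal.IsMaximal.under (𝓞 K) P
  have hF0 : P.under (𝓞 F) ≠ ⊥ := mt Ideal.eq_bot_of_comap_eq_bot hP0
  -- `e(𝔓|K) ∣ p`
  have hdvd : P.ramificationIdx (𝓞 K) ∣ p := hKM ▸ ramificationIdx_dvd_finrank P
  -- `e(𝔓 ∩ E | F) = 1`
  have h1 : (P.under (𝓞 E)).ramificationIdx (𝓞 F) = 1 := by
    let w : HeightOneSpectrum (𝓞 F) := ⟨P.under (𝓞 F), inferInstance, hF0⟩
    haveI : Algebra.IsUnramifiedAt (𝓞 F) (P.under (𝓞 E)) :=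
      hunr w (P.under (𝓞 E)) inferInstance ⟨(Ideal.under_under (B := 𝓞 E) P).symm⟩
    exact Ideal.ramificationIdx_eq_one _ _
  -- `e(𝔓|E) ≤ 2`
  haveI : NoZeroSMulDivisors (𝓞 E) (𝓞 M) := ⟨fun {c z} h => by
    rw [Algebra.smul_def, mul_eq_zero] at h
    exact h.imp_left fun hc => RingOfIntegers.algebraMap.injective E M (by rw [hc, map_zero])⟩
  have h2' : P.ramificationIdx (𝓞 E) ≤ 2 := by
    have h := Ideal.ramificationIdx_le_finrank (𝓞 M) E M P (p := P.under (𝓞 E))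
    rw [Ideal.ramificationIdx'_eq_ramificationIdx (P.under (𝓞 E)) P
      (mt Ideal.eq_bot_of_comap_eq_bot hP0 : P.under (𝓞 E) ≠ ⊥), hEM] at h
    exact h
  -- multiplicativity in the towers `F ⊆ E ⊆ M` and `F ⊆ K ⊆ M`
  have htE : P.ramificationIdx (𝓞 F) =
      (P.under (𝓞 E)).ramificationIdx (𝓞 F) * P.ramificationIdx (𝓞 E) :=
    Ideal.ramificationIdx_tower (R := 𝓞 F) (P.under (𝓞 E)) P
  have htK : P.ramificationIdx (𝓞 F) =
      (P.under (𝓞 K)).ramificationIdx (𝓞 F) * P.ramificationIdx (𝓞 K) :=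
    Ideal.ramificationIdx_tower (R := 𝓞 F) (P.under (𝓞 K)) P
  have hposK : 0 < (P.under (𝓞 K)).ramificationIdx (𝓞 F) := Ideal.ramificationIdx_pos _ _
  have hle : P.ramificationIdx (𝓞 K) ≤ 2 := by
    have : P.ramificationIdx (𝓞 K) ≤ P.ramificationIdx (𝓞 F) := by
      rw [htK]; exact Nat.le_mul_of_pos_left _ hposK
    rw [h1, one_mul] at htE
    omega
  rcases (Nat.dvd_prime hp).mp hdvd with h | h
  · exact h
  · exfalso
    rw [h] at hle
    have := hp.two_le
    omega

/-! ### §4. Automorphisms: `Aut(K̄/F)` commutes with `Aut(K̄/K)` on `M` -/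

/-- **`g (h y) = h (g y)` for `y ∈ M`, `g ∈ Aut(K̄/F)`, `h ∈ Aut(K̄/K)`** when `K/F`, `E/F` are normal
and `Gal(E/F)` is cyclic: on `K₁` because `h` fixes `K₁` pointwise and `g(K₁) = K₁`; on `E`
because both restrict to the abelian group `Gal(E/F)`; hence on `K₁ E = M`.
[cite: Lang1990, Ch. 13 §2, Thm. 2.1 (proof: `G = G⁺ × G⁻`)] [folklore] -/
theorem apply_comm {E : IntermediateField F (AlgebraicClosure K)}
    {M : IntermediateField K (AlgebraicClosure K)}
    (hM : M.restrictScalars F =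
      (IsScalarTower.toAlgHom F K (AlgebraicClosure K)).fieldRange ⊔ E)
    [Normal F K] [Normal F E] [IsCyclic (E ≃ₐ[F] E)] (g : (AlgebraicClosure K) ≃ₐ[F] (AlgebraicClosure K))
    (h : (AlgebraicClosure K) ≃ₐ[K] (AlgebraicClosure K)) {y : (AlgebraicClosure K)} (hy : y ∈ M) : g (h y) = h (g y) := by
  let h' : (AlgebraicClosure K) ≃ₐ[F] (AlgebraicClosure K) := h.restrictScalars F
  -- the equalizer of `g ∘ h` and `h ∘ g`, an intermediate field over `F`
  let S : IntermediateField F (AlgebraicClosure K) :=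
    (AlgHom.equalizer ((h'.trans g : (AlgebraicClosure K) ≃ₐ[F] (AlgebraicClosure K)) : (AlgebraicClosure K) →ₐ[F] (AlgebraicClosure K))
      ((g.trans h' : (AlgebraicClosure K) ≃ₐ[F] (AlgebraicClosure K)) : (AlgebraicClosure K) →ₐ[F] (AlgebraicClosure K))).toIntermediateField fun z hz => by
      rw [AlgHom.mem_equalizer] at hz ⊢
      change (h'.trans g) z⁻¹ = (g.trans h') z⁻¹
      change (h'.trans g) z = (g.trans h') z at hz
      rw [map_inv₀, map_inv₀, hz]
  have hmem : ∀ z, z ∈ S ↔ g (h z) = h (g z) := fun z => by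
    change z ∈ AlgHom.equalizer _ _ ↔ _
    rw [AlgHom.mem_equalizer]
    rfl
  suffices hle : (IsScalarTower.toAlgHom F K (AlgebraicClosure K)).fieldRange ⊔ E ≤ S from
    (hmem y).mp (hle ((mem_iff hM y).mp hy))
  apply sup_le
  · rintro _ ⟨k, rfl⟩
    rw [hmem]
    change g (h (algebraMap K (AlgebraicClosure K) k)) = h (g (algebraMap K (AlgebraicClosure K) k))
    have hk : g (algebraMap K (AlgebraicClosure K) k) ∈ (IsScalarTower.toAlgHom F K (AlgebraicClosure K)).fieldRange := by
      rw [← map_fieldRange_eq (F := F) (K := K) g]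
      exact ⟨algebraMap K (AlgebraicClosure K) k, ⟨k, rfl⟩, rfl⟩
    obtain ⟨k', hk'⟩ := hk
    change algebraMap K (AlgebraicClosure K) k' = g (algebraMap K (AlgebraicClosure K) k) at hk'
    rw [AlgEquiv.commutes, ← hk', AlgEquiv.commutes]
  · intro z hz
    rw [hmem]
    -- both sides through the restrictions to `E`
    obtain ⟨σ, hσ⟩ := IsCyclic.exists_generator (α := E ≃ₐ[F] E)
    have hcomm : ∀ a b : E ≃ₐ[F] E, a * b = b * a := fun a b => by
      obtain ⟨i, rfl⟩ := Subgroup.mem_zpowers_iff.mp (hσ a)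
      obtain ⟨j, rfl⟩ := Subgroup.mem_zpowers_iff.mp (hσ b)
      rw [← zpow_add, ← zpow_add, add_comm]
    have hg : ∀ (φ : (AlgebraicClosure K) ≃ₐ[F] (AlgebraicClosure K)) (w : E), φ (w : (AlgebraicClosure K)) = ((φ.restrictNormal E w : E) : (AlgebraicClosure K)) :=
      fun φ w => (AlgEquiv.restrictNormal_commutes φ E w).symm
    have hz' : z = ((⟨z, hz⟩ : E) : (AlgebraicClosure K)) := rfl
    rw [hz']
    change g (h' _) = h' (g _)
    rw [hg h', hg g, hg g, hg h', ← AlgEquiv.mul_apply, ← AlgEquiv.mul_apply, hcomm]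

end Literature.NumberTheory.NumberFields.QuadraticLift

end
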